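import Literature.Topology.FourManifolds.SimplifiedBrokenLefschetzSides
import Mathlib.Analysis.Normed.Module.Connected
import HarnessLib

/-!
# The two sides of a simplified broken Lefschetz fibration: the fibre genus is constant over each
# open hemisphere off the Lefschetz values, and the two genera are `h + 1` and `h`

Topic `Literature/Topology/FourManifolds`; groundwork for the Euler count
`card_eq_four_mul_of_sblf_of_homotopyEquiv_sphere_four` (Baykur 2012, Lemma 7) of
`SimplifiedBrokenLefschetzFibration.lean`.  Everything here is **proved**; there are no
definitions and no named facts.

After the normalisation of the round image to the equator `{y | y₂ = 0}`
(`IsSimplifiedBrokenLefschetzFibration.exists_image_round_eq_sphereEquator`), the regular values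
of an SBLF `f : X → S²` with Lefschetz set `L` are the points of the two open hemispheres
`{y₂ > 0}`, `{y₂ < 0}` that are not Lefschetz values.  Each hemisphere minus the finitely many
Lefschetz values is open and connected (`isPreconnected_setOf_inner_lt_zero_diff`: an open
hemisphere is a copy of `ℝ²`, and the complement of a finite set in `ℝ²` is path connected), so by
Ehresmann's theorem (the tree's `isFibreBundleWith_restrictPreimage`) the regular fibres over it
are pairwise homeomorphic and `rank H₁` of the fibre is constant on it; since fibres of both
genera `h + 1` and `h` occur (`exists_higher`, `exists_lower`), the two constants are
`2(h + 1)` and `2h` in some order (`IsSimplifiedBrokenLefschetzFibration.exists_hemisphere_ranks`)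
— Baykur 2012, proof of Lemma 7: *"`X` decomposes into `D² × Σ_{g-1}`, a round cobordism …, and
a genus `g` Lefschetz fibration over `D²`"*; Baykur–Kamada 2015, §2: the *lower side* of genus
`g - 1` and the *higher side* of genus `g`.

## References

* R. İ. Baykur, *Broken Lefschetz fibrations and smooth structures on 4-manifolds*, Geom. Topol.
  Monogr. 18 (2012), Lemma 7. [Baykur2012]
* R. İ. Baykur, S. Kamada, *Classification of broken Lefschetz fibrations with small fiber
  genera*, J. Math. Soc. Japan 67 (2015), §2. [BaykurKamada2015]
* Th. Bröcker, K. Jänich, *Introduction to Differential Topology* (1982), (8.12).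
  [BrockerJanichIDT1982]
-/

noncomputable section

open scoped Manifold ContDiff Topology InnerProductSpace
open Set Function Metric
open Literature.AlgebraicTopology.SingularHomology Literature.AlgebraicTopology.Homotopy

namespace Literature.Topology.FourManifolds

universe u

/-! ### An open hemisphere minus a finite set is connected -/

section Hemisphere

/-- **An open hemisphere of `S²` minus finitely many points is (pre)connected**: the hemisphere
opposite `v` is the homeomorphic image of `ℝ²` under `σᵥ⁻¹ ∘ univBall 0 2`
(`setOf_inner_lt_zero_inter_preimage`), and the complement of a finite set in `ℝ²` is path
connected (Mathlib's `Set.Countable.isPathConnected_compl_of_one_lt_rank`). [folklore] -/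
theorem isPreconnected_setOf_inner_lt_zero_diff
    (v : (Metric.sphere (0 : EuclideanSpace ℝ (Fin 3)) 1))
    {F : Set (Metric.sphere (0 : EuclideanSpace ℝ (Fin 3)) 1)} (hF : F.Finite) :
    IsPreconnected ({y : (Metric.sphere (0 : EuclideanSpace ℝ (Fin 3)) 1) |
        ⟪(y : EuclideanSpace ℝ (Fin 3)), (v : EuclideanSpace ℝ (Fin 3))⟫_ℝ < 0} \ F) := by
  haveI : Fact (Module.finrank ℝ (EuclideanSpace ℝ (Fin 3)) = 1 + 1 + 1) :=
    ⟨finrank_euclideanSpace_fin⟩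
  set ψ : EuclideanSpace ℝ (Fin (1 + 1)) → (Metric.sphere (0 : EuclideanSpace ℝ (Fin 3)) 1) :=
    fun w => (stereographic' (1 + 1) v).symm
      (OpenPartialHomeomorph.univBall (0 : EuclideanSpace ℝ (Fin (1 + 1))) 2 w) with hψ
  set κ : (Metric.sphere (0 : EuclideanSpace ℝ (Fin 3)) 1) → EuclideanSpace ℝ (Fin (1 + 1)) :=
    fun y => (OpenPartialHomeomorph.univBall (0 : EuclideanSpace ℝ (Fin (1 + 1))) 2).symm
      (stereographic' (1 + 1) v y) with hκ
  have hψc : Continuous ψ := (contMDiff_stereographic'_symm_univBall (n := 1) v).continuous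
  have hκψ : ∀ w, κ (ψ w) = w := fun w =>
    univBall_symm_stereographic'_stereographic'_symm_univBall (n := 1) v w
  have hψinj : Injective ψ := fun w w' hww => by rw [← hκψ w, ← hκψ w', hww]
  have hset : {y : (Metric.sphere (0 : EuclideanSpace ℝ (Fin 3)) 1) |
        ⟪(y : EuclideanSpace ℝ (Fin 3)), (v : EuclideanSpace ℝ (Fin 3))⟫_ℝ < 0} \ F =
      {y : (Metric.sphere (0 : EuclideanSpace ℝ (Fin 3)) 1) |
        ⟪(y : EuclideanSpace ℝ (Fin 3)), (v : EuclideanSpace ℝ (Fin 3))⟫_ℝ < 0} ∩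
        κ ⁻¹' (ψ ⁻¹' F)ᶜ := by
    ext y
    constructor
    · rintro ⟨hy, hyF⟩
      refine ⟨hy, ?_⟩
      show ψ (κ y) ∉ F
      rw [show ψ (κ y) = y from
        stereographic'_symm_univBall_univBall_symm_stereographic' (n := 1) hy]
      exact hyF
    · rintro ⟨hy, hyF⟩
      refine ⟨hy, ?_⟩
      have hyF' : ψ (κ y) ∉ F := hyF
      rwa [show ψ (κ y) = y from
        stereographic'_symm_univBall_univBall_symm_stereographic' (n := 1) hy] at hyF'
  rw [hset, hκ, setOf_inner_lt_zero_inter_preimage (n := 1) v]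
  have hrank : 1 < Module.rank ℝ (EuclideanSpace ℝ (Fin (1 + 1))) := by
    rw [← Module.finrank_eq_rank, finrank_euclideanSpace_fin]
    norm_num
  have hcount : (ψ ⁻¹' F).Countable := (hF.preimage hψinj.injOn).countable
  exact ((hcount.isPathConnected_compl_of_one_lt_rank hrank).image hψc).isConnected.isPreconnected

/-- The south pole `-e₂` of `S²`. [folklore] -/
theorem single_two_mem_sphere_fin_three (s : ℝ) (hs : s = 1 ∨ s = -1) :
    EuclideanSpace.single (2 : Fin 3) s ∈ Metric.sphere (0 : EuclideanSpace ℝ (Fin 3)) 1 := by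
  rw [mem_sphere_zero_iff_norm, EuclideanSpace.norm_eq]
  rcases hs with rfl | rfl <;> simp

/-- `⟪y, s e₂⟫ = s y₂`. [folklore] -/
theorem real_inner_single_two_fin_three (y : EuclideanSpace ℝ (Fin 3)) (s : ℝ) :
    ⟪y, EuclideanSpace.single (2 : Fin 3) s⟫_ℝ = s * y 2 := by
  rw [EuclideanSpace.inner_single_right]
  simp

/-- **The open upper hemisphere `{y₂ > 0}` minus a finite set is preconnected.** [folklore] -/
theorem isPreconnected_setOf_two_pos_diff
    {F : Set (Metric.sphere (0 : EuclideanSpace ℝ (Fin 3)) 1)} (hF : F.Finite) :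
    IsPreconnected ({y : (Metric.sphere (0 : EuclideanSpace ℝ (Fin 3)) 1) |
        0 < (y : EuclideanSpace ℝ (Fin 3)) 2} \ F) := by
  have h := isPreconnected_setOf_inner_lt_zero_diff
    ⟨EuclideanSpace.single (2 : Fin 3) (-1 : ℝ), single_two_mem_sphere_fin_three _ (Or.inr rfl)⟩ hF
  convert h using 3 with y
  simp only [real_inner_single_two_fin_three, neg_mul, one_mul, neg_lt_zero]

/-- **The open lower hemisphere `{y₂ < 0}` minus a finite set is preconnected.** [folklore] -/
theorem isPreconnected_setOf_two_neg_diff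
    {F : Set (Metric.sphere (0 : EuclideanSpace ℝ (Fin 3)) 1)} (hF : F.Finite) :
    IsPreconnected ({y : (Metric.sphere (0 : EuclideanSpace ℝ (Fin 3)) 1) |
        (y : EuclideanSpace ℝ (Fin 3)) 2 < 0} \ F) := by
  have h := isPreconnected_setOf_inner_lt_zero_diff
    ⟨EuclideanSpace.single (2 : Fin 3) (1 : ℝ), single_two_mem_sphere_fin_three _ (Or.inl rfl)⟩ hF
  convert h using 3 with y
  simp only [real_inner_single_two_fin_three, one_mul]

end Hemisphere

/-! ### Fibre genus over the two sides -/

namespace IsSimplifiedBrokenLefschetzFibration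

variable {X : Type u} [TopologicalSpace X] [T2Space X] [SecondCountableTopology X]
  [CompactSpace X] [ChartedSpace (EuclideanSpace ℝ (Fin 4)) X] [IsManifold (𝓡 4) ∞ X]
  {o : SmoothOrientation (𝓡 4) X} {f : X → (Metric.sphere (0 : EuclideanSpace ℝ (Fin 3)) 1)}
  {L : Finset X} {h : ℕ}

omit [T2Space X] [SecondCountableTopology X] [CompactSpace X] in
/-- **With equatorial round image, a point off the equator that is not a Lefschetz value is a
regular value.** [cite: Baykur2012, Lemma 7] -/
theorem regularValue_of_apply_two_ne_zero (hf : IsSimplifiedBrokenLefschetzFibration o f L h)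
    (hround : f '' ({p : X | ¬ Surjective (mfderiv (𝓡 4) (𝓡 2) f p)} \ (↑L : Set X)) =
      sphereEquator 1)
    {y : (Metric.sphere (0 : EuclideanSpace ℝ (Fin 3)) 1)} (hy : (y : EuclideanSpace ℝ (Fin 3)) 2 ≠ 0)
    (hyL : y ∉ f '' (↑L : Set X)) :
    ∀ q, f q = y → Surjective (mfderiv (𝓡 4) (𝓡 2) f q) := by
  have _ := hf
  intro q hq
  by_contra hq'
  by_cases hqL : q ∈ L
  · exact hyL ⟨q, by simpa using hqL, hq⟩
  · have hmem : y ∈ sphereEquator 1 := by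
      rw [← hround]
      exact ⟨q, ⟨hq', by simpa using hqL⟩, hq⟩
    rw [mem_sphereEquator_iff] at hmem
    exact hy hmem

/-- **Regular fibres over a connected open set of regular values have the same first Betti
number** (Ehresmann, the tree's `isFibreBundleWith_restrictPreimage`: the fibres are pairwise
homeomorphic). [cite: BrockerJanichIDT1982, (8.12)] -/
theorem finrank_fibre_eq_of_mem (hf : IsSimplifiedBrokenLefschetzFibration o f L h)
    {W : Set (Metric.sphere (0 : EuclideanSpace ℝ (Fin 3)) 1)} (hWo : IsOpen W)
    (hWc : IsPreconnected W)
    (hW : ∀ y ∈ W, ∀ q, f q = y → Surjective (mfderiv (𝓡 4) (𝓡 2) f q))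
    {y y' : (Metric.sphere (0 : EuclideanSpace ℝ (Fin 3)) 1)} (hy : y ∈ W) (hy' : y' ∈ W) :
    Module.finrank ℤ (singularHomology ℤ ℤ ↥(f ⁻¹' {y'}) 1) =
      Module.finrank ℤ (singularHomology ℤ ℤ ↥(f ⁻¹' {y}) 1) := by
  have hB := isFibreBundleWith_restrictPreimage hf.contMDiff hWo hWc hW hy
  obtain ⟨φ⟩ := hB.nonempty_fibre_homeomorph ⟨y', hy'⟩
  -- the fibre of the restriction over `y'` is the fibre of `f` over `y'`
  have hemb : Topology.IsEmbedding (fun z : ↥((W.restrictPreimage f) ⁻¹' {⟨y', hy'⟩}) =>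
      ((z : ↥(f ⁻¹' W)) : X)) :=
    Topology.IsEmbedding.subtypeVal.comp Topology.IsEmbedding.subtypeVal
  have hrg : range (fun z : ↥((W.restrictPreimage f) ⁻¹' {⟨y', hy'⟩}) =>
      ((z : ↥(f ⁻¹' W)) : X)) = f ⁻¹' {y'} := by
    ext x
    simp only [mem_range, mem_preimage, mem_singleton_iff]
    constructor
    · rintro ⟨z, rfl⟩
      have hz := z.2
      rw [mem_preimage, mem_singleton_iff, Subtype.ext_iff] at hz
      exact hz
    · intro hx
      have hxW : x ∈ f ⁻¹' W := by rw [mem_preimage, hx]; exact hy'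
      exact ⟨⟨⟨x, hxW⟩, by rw [mem_preimage, mem_singleton_iff, Subtype.ext_iff]; exact hx⟩, rfl⟩
  have ψ : ↥(f ⁻¹' {y'}) ≃ₜ ↥(f ⁻¹' {y}) :=
    ((hemb.toHomeomorph.trans (Homeomorph.setCongr hrg)).symm).trans φ
  exact (singularHomology.mapIso ℤ ℤ ψ 1).toLinearEquiv.finrank_eq

omit [T2Space X] [SecondCountableTopology X] [CompactSpace X] in
/-- The first Betti number of a regular fibre is `2(h + 1)` or `2h`, and `H₁` of the fibre is free
of that rank (the genus clause of `IsSimplifiedBrokenLefschetzFibration.fibre`). [cite: Baykur2012, Lemma 7] -/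
theorem finrank_fibre_mem (hf : IsSimplifiedBrokenLefschetzFibration o f L h)
    {y : (Metric.sphere (0 : EuclideanSpace ℝ (Fin 3)) 1)}
    (hy : ∀ q, f q = y → Surjective (mfderiv (𝓡 4) (𝓡 2) f q)) :
    (Module.finrank ℤ (singularHomology ℤ ℤ ↥(f ⁻¹' {y}) 1) = 2 * (h + 1) ∨
      Module.finrank ℤ (singularHomology ℤ ℤ ↥(f ⁻¹' {y}) 1) = 2 * h) ∧
    Nonempty ((Fin (Module.finrank ℤ (singularHomology ℤ ℤ ↥(f ⁻¹' {y}) 1)) → ℤ) ≃ₗ[ℤ]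
      singularHomology ℤ ℤ ↥(f ⁻¹' {y}) 1) := by
  rcases (hf.fibre y hy).2 with ⟨⟨l⟩⟩ | ⟨⟨l⟩⟩
  · have hr : Module.finrank ℤ (singularHomology ℤ ℤ ↥(f ⁻¹' {y}) 1) = 2 * (h + 1) := by
      rw [← l.finrank_eq, Module.finrank_fin_fun]
    exact ⟨Or.inl hr, ⟨(LinearEquiv.funCongrLeft ℤ ℤ (finCongr hr.symm)).trans l⟩⟩
  · have hr : Module.finrank ℤ (singularHomology ℤ ℤ ↥(f ⁻¹' {y}) 1) = 2 * h := by
      rw [← l.finrank_eq, Module.finrank_fin_fun]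
    exact ⟨Or.inr hr, ⟨(LinearEquiv.funCongrLeft ℤ ℤ (finCongr hr.symm)).trans l⟩⟩

/-- **The two sides of an SBLF with equatorial round image carry the two fibre genera** (Baykur
2012, proof of Lemma 7; Baykur–Kamada 2015, §2: the *higher side* of genus `g = h + 1` and the
*lower side* of genus `g - 1 = h`).  For an SBLF `f : X → S²` on a closed 4-manifold whose round
image is the equator `{y | y₂ = 0}`, there are `r₊, r₋ ∈ ℕ` with `r₊ + r₋ = 2(h + 1) + 2h` such
that every point `y` of the open upper hemisphere `{y₂ > 0}` (resp. lower hemisphere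
`{y₂ < 0}`) that is not a Lefschetz value is a regular value with `H₁(f⁻¹(y); ℤ) ≅ ℤ^{r₊}`
(resp. `ℤ^{r₋}`). [cite: Baykur2012, Lemma 7] [cite: BaykurKamada2015, §2 (arXiv p. 7)] -/
theorem exists_hemisphere_ranks (hf : IsSimplifiedBrokenLefschetzFibration o f L h)
    (hround : f '' ({p : X | ¬ Surjective (mfderiv (𝓡 4) (𝓡 2) f p)} \ (↑L : Set X)) =
      sphereEquator 1) :
    ∃ rp rm : ℕ, rp + rm = 2 * (h + 1) + 2 * h ∧
      (∀ y : (Metric.sphere (0 : EuclideanSpace ℝ (Fin 3)) 1), 0 < (y : EuclideanSpace ℝ (Fin 3)) 2 →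
        y ∉ f '' (↑L : Set X) →
        (∀ q, f q = y → Surjective (mfderiv (𝓡 4) (𝓡 2) f q)) ∧
          Nonempty ((Fin rp → ℤ) ≃ₗ[ℤ] singularHomology ℤ ℤ ↥(f ⁻¹' {y}) 1)) ∧
      (∀ y : (Metric.sphere (0 : EuclideanSpace ℝ (Fin 3)) 1), (y : EuclideanSpace ℝ (Fin 3)) 2 < 0 →
        y ∉ f '' (↑L : Set X) →
        (∀ q, f q = y → Surjective (mfderiv (𝓡 4) (𝓡 2) f q)) ∧
          Nonempty ((Fin rm → ℤ) ≃ₗ[ℤ] singularHomology ℤ ℤ ↥(f ⁻¹' {y}) 1)) := by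
  -- the two sides
  set Wp : Set (Metric.sphere (0 : EuclideanSpace ℝ (Fin 3)) 1) :=
    {y | 0 < (y : EuclideanSpace ℝ (Fin 3)) 2} \ f '' (↑L : Set X) with hWp
  set Wm : Set (Metric.sphere (0 : EuclideanSpace ℝ (Fin 3)) 1) :=
    {y | (y : EuclideanSpace ℝ (Fin 3)) 2 < 0} \ f '' (↑L : Set X) with hWm
  have hLfin : (f '' (↑L : Set X)).Finite := L.finite_toSet.image f
  have hc2 : Continuous fun y : (Metric.sphere (0 : EuclideanSpace ℝ (Fin 3)) 1) =>
      (y : EuclideanSpace ℝ (Fin 3)) 2 := (EuclideanSpace.proj (2 : Fin 3)).continuous.comp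
    continuous_subtype_val
  have hWpo : IsOpen Wp := (isOpen_lt continuous_const hc2).sdiff hLfin.isClosed
  have hWmo : IsOpen Wm := (isOpen_lt hc2 continuous_const).sdiff hLfin.isClosed
  have hWpc : IsPreconnected Wp := isPreconnected_setOf_two_pos_diff hLfin
  have hWmc : IsPreconnected Wm := isPreconnected_setOf_two_neg_diff hLfin
  have hWpreg : ∀ y ∈ Wp, ∀ q, f q = y → Surjective (mfderiv (𝓡 4) (𝓡 2) f q) :=
    fun y hy => hf.regularValue_of_apply_two_ne_zero hround (ne_of_gt hy.1) hy.2
  have hWmreg : ∀ y ∈ Wm, ∀ q, f q = y → Surjective (mfderiv (𝓡 4) (𝓡 2) f q) :=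
    fun y hy => hf.regularValue_of_apply_two_ne_zero hround (ne_of_lt hy.1) hy.2
  -- a regular value lies on one of the two sides
  have hside : ∀ y, (∀ q, f q = y → Surjective (mfderiv (𝓡 4) (𝓡 2) f q)) → y ∈ Wp ∨ y ∈ Wm := by
    intro y hy
    have hyL : y ∉ f '' (↑L : Set X) := by
      rintro ⟨q, hq, rfl⟩
      exact hf.not_surjective_mfderiv_of_mem (by simpa using hq) (hy q rfl)
    have hy2 : (y : EuclideanSpace ℝ (Fin 3)) 2 ≠ 0 := by
      intro h0
      have hyE : y ∈ sphereEquator 1 := (mem_sphereEquator_iff y).2 h0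
      rw [← hround] at hyE
      obtain ⟨q, ⟨hq, -⟩, hqy⟩ := hyE
      exact hq (hy q hqy)
    rcases lt_or_gt_of_ne hy2 with hlt | hgt
    · exact Or.inr ⟨hlt, hyL⟩
    · exact Or.inl ⟨hgt, hyL⟩
  -- notation for the first Betti number of the fibre
  set r : (Metric.sphere (0 : EuclideanSpace ℝ (Fin 3)) 1) → ℕ :=
    fun y => Module.finrank ℤ (singularHomology ℤ ℤ ↥(f ⁻¹' {y}) 1) with hr
  have hconst_p : ∀ y ∈ Wp, ∀ y' ∈ Wp, r y' = r y := fun y hy y' hy' =>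
    hf.finrank_fibre_eq_of_mem hWpo hWpc hWpreg hy hy'
  have hconst_m : ∀ y ∈ Wm, ∀ y' ∈ Wm, r y' = r y := fun y hy y' hy' =>
    hf.finrank_fibre_eq_of_mem hWmo hWmc hWmreg hy hy'
  -- both genera occur, on different sides
  obtain ⟨y₁, hy₁reg, ⟨l₁⟩⟩ := hf.exists_higher
  obtain ⟨y₂, hy₂reg, ⟨l₂⟩⟩ := hf.exists_lower
  have hr₁ : r y₁ = 2 * (h + 1) := by
    simp only [hr]; rw [← l₁.finrank_eq, Module.finrank_fin_fun]
  have hr₂ : r y₂ = 2 * h := by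
    simp only [hr]; rw [← l₂.finrank_eq, Module.finrank_fin_fun]
  have hne : r y₁ ≠ r y₂ := by rw [hr₁, hr₂]; omega
  -- packaging: on a side containing `y₁` the rank is `r y₁`, etc.
  have key : ∀ (W : Set (Metric.sphere (0 : EuclideanSpace ℝ (Fin 3)) 1)) (y₀ : _) (_ : y₀ ∈ W)
      (_ : ∀ y ∈ W, ∀ y' ∈ W, r y' = r y)
      (_ : ∀ y ∈ W, ∀ q, f q = y → Surjective (mfderiv (𝓡 4) (𝓡 2) f q)),
      ∀ y ∈ W, (∀ q, f q = y → Surjective (mfderiv (𝓡 4) (𝓡 2) f q)) ∧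
        Nonempty ((Fin (r y₀) → ℤ) ≃ₗ[ℤ] singularHomology ℤ ℤ ↥(f ⁻¹' {y}) 1) := by
    intro W y₀ hy₀ hconst hreg y hy
    refine ⟨hreg y hy, ?_⟩
    obtain ⟨-, ⟨l⟩⟩ := hf.finrank_fibre_mem (hreg y hy)
    have hry : r y = r y₀ := hconst y₀ hy₀ y hy
    exact ⟨(LinearEquiv.funCongrLeft ℤ ℤ (finCongr hry)).trans l⟩
  rcases hside y₁ hy₁reg with h₁p | h₁m <;> rcases hside y₂ hy₂reg with h₂p | h₂m
  · exact absurd (hconst_p y₂ h₂p y₁ h₁p) hne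
  · refine ⟨r y₁, r y₂, by rw [hr₁, hr₂], fun y hy hyL => ?_, fun y hy hyL => ?_⟩
    · exact key Wp y₁ h₁p hconst_p hWpreg y ⟨hy, hyL⟩
    · exact key Wm y₂ h₂m hconst_m hWmreg y ⟨hy, hyL⟩
  · refine ⟨r y₂, r y₁, by rw [hr₁, hr₂]; ring, fun y hy hyL => ?_, fun y hy hyL => ?_⟩
    · exact key Wp y₂ h₂p hconst_p hWpreg y ⟨hy, hyL⟩
    · exact key Wm y₁ h₁m hconst_m hWmreg y ⟨hy, hyL⟩
  · exact absurd (hconst_m y₂ h₂m y₁ h₁m) hne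

end IsSimplifiedBrokenLefschetzFibration

end Literature.Topology.FourManifolds
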